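import Literature.NumberTheory.LFunctions.DedekindZetaClassSumCont
import Mathlib.MeasureTheory.Measure.Haar.Unique
import Mathlib.NumberTheory.NumberField.Discriminant.Different
import HarnessLib

/-!
# Symmetry and scaling of Hecke's FE-pairs (Hecke's continuation of `ζ_K`, towards the functional equation)

Topic `Literature/NumberTheory/LFunctions`, sibling proofs file (D-0014) of `DedekindZeta.lean`,
continuing `DedekindZetaMellin.lean`, `DedekindZetaMellinProofs.lean`, `DedekindZetaThetaProofs.lean`
and `DedekindZetaClassSumCont.lean` (Neukirch, *Algebraic Number Theory*, Ch. VII §5) towards the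
discharge of the functional equation `Literature.NumberTheory.LFunctions.completedDedekindZeta_one_sub`
(`Λ_K(1 - s) = Λ_K(s)`, Neukirch VII (5.10)). Everything here is PROVED; no definitions.

Mathlib's Mellin principle (`WeakFEPair.functional_equation`, Neukirch VII (1.4)) gives, for the
weak FE-pair `P = heckePair K hinv 𝔞 h𝔞` of a nonzero fractional ideal `𝔞`
(`DedekindZetaMellin.lean`: `f = f_{𝔞,1}`, `g = f_{(𝔞𝔡)⁻¹,-1}`, `k = 1/2`, `ε = (𝔑(𝔞)√|d_K|)⁻¹`),
`Λ_P(1/2 - z) = ε • Λ_{P.symm}(z)`. To turn this into the functional equation of `ζ_K` one needs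
to know `P.symm` and how `Λ` depends on the ideal within its class. This file supplies:

* `heckeFi_neg_one` — `f_{𝔞,-1} = f_{𝔞,1}`: the theta series is invariant under the unit
  translations `c ↦ c + m` of Hecke's coordinates (`thetaIdeal_heckeCoord_add_intCast`), and
  `c ↦ 1 - c` preserves Lebesgue measure on the cube (Neukirch VII (5.8): `F⁻¹` is again a
  fundamental domain);
* `absNorm_dual` — `𝔑((𝔞𝔡)⁻¹) = (𝔑(𝔞)|d_K|)⁻¹` (Mathlib `FractionalIdeal.dual_eq_mul_inv`,
  `coeIdeal_differentIdeal`, `NumberField.absNorm_differentIdeal`);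
* `heckePair_symm` — **`P.symm` is the FE-pair of the dual ideal `(𝔞𝔡)⁻¹`** (with
  `FractionalIdeal.dual_dual` and `ε⁻¹ = 𝔑(𝔞)√|d_K| = ε_{(𝔞𝔡)⁻¹}`);
* `exists_coneEquiv_spanSingleton_mul` — for `x ∈ K^×`, the cone points of `𝔞` and of `x𝔞`
  (representatives of the nonzero elements modulo units in Mathlib's fundamental cone) correspond,
  norms being multiplied by `|N(x)|` (Neukirch VII (5.3));
* `lintegral_heckeFi_spanSingleton_mul`, `heckePair_Λ_spanSingleton_mul_ofReal`,
  `heckePair_Λ_spanSingleton_mul` — **scaling**: `Λ_{x𝔞}(z) = |N(x)|^{-2z} Λ_𝔞(z)` for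
  `z ∉ {0, 1/2}`, first for real `z > 1/2` from the unfolded Mellin transform
  (`lintegral_Ioi_rpow_mul_heckeFi_sub_one`, `heckePair_Λ_ofReal` of `DedekindZetaMellinProofs.lean`),
  then on `ℂ ∖ {0, 1/2}` by the identity theorem; i.e. `𝔑(𝔞)^{2z} Λ_𝔞(z)` depends only on the
  class of `𝔞` (Neukirch VII (5.9): it is `Z(𝔎, 2z)` up to Hecke's constant).

## References

* J. Neukirch, *Algebraic Number Theory*, Grundlehren 322, Springer 1999, Ch. VII (5.3), (5.8),
  (5.9). [NeukirchANT1999]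
* Mathlib: `NumberTheory.LSeries.AbstractFuncEq` (`WeakFEPair`, D. Loeffler);
  `RingTheory.DedekindDomain.Different` (`FractionalIdeal.dual`);
  `NumberTheory.NumberField.Discriminant.Different` (`absNorm_differentIdeal`).
-/

noncomputable section


open scoped NumberField nonZeroDivisors
open NumberField NumberField.InfinitePlace NumberField.Units MeasureTheory Complex Filter Topology Set

namespace Literature.NumberTheory.LFunctions.NumberField

variable {K : Type*} [Field K] [NumberField K]

/-! ## The sign symmetry `f_{𝔞,-1} = f_{𝔞,1}` -/

/-- Unit invariance of the theta series in Hecke's coordinates: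
`θ_𝔞(i y(c + m, t)) = θ_𝔞(i y(c, t))` for `m ∈ ℤ^{r-1}` (`y(c+m,t) = |ε_m|² y(c,t)` and
`a ↦ ε_m a` permutes `𝔞`; Neukirch VII §5, proof of (5.5)). [folklore] -/
theorem thetaIdeal_heckeCoord_add_intCast (I : FractionalIdeal (𝓞 K)⁰ K) (c : Fin (rank K) → ℝ)
    (m : Fin (rank K) → ℤ) (t : ℝ) :
    thetaIdeal K I (heckeCoord K (c + fun i ↦ (m i : ℝ)) t) = thetaIdeal K I (heckeCoord K c t) := by
  let e : {a : K // a ∈ I} ≃ {a : K // a ∈ I} :=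
    { toFun := fun a ↦ ⟨(fundUnit K m : K) * a, unit_mul_mem (I := I) _ a.2⟩
      invFun := fun a ↦ ⟨(fundUnit K (-m) : K) * a, unit_mul_mem (I := I) _ a.2⟩
      left_inv := fun a ↦ Subtype.ext (fundUnit_neg_mul_fundUnit_mul m (a : K))
      right_inv := fun a ↦ Subtype.ext (by
        have h := fundUnit_neg_mul_fundUnit_mul (-m) (a : K)
        rwa [neg_neg] at h) }
  unfold thetaIdeal
  calc ∑' a : I, thetaSummand K (heckeCoord K (c + fun i ↦ (m i : ℝ)) t) (a : K)
      = ∑' a : {a : K // a ∈ I}, thetaSummand K (heckeCoord K c t) ((e a : {a : K // a ∈ I}) : K) :=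
        tsum_congr fun a ↦ (thetaSummand_fundUnit_mul m (a : K) c t).symm
    _ = ∑' b : I, thetaSummand K (heckeCoord K c t) (b : K) :=
        e.tsum_eq (fun b : {a : K // a ∈ I} ↦ thetaSummand K (heckeCoord K c t) (b : K))

/-- **`f_{𝔞,-1} = f_{𝔞,1}`**: the cube integrals of `θ_𝔞(i y(-c, t))` and `θ_𝔞(i y(c, t))` agree,
because `-c = (1 - c) + (-1, …, -1)`, the theta series is invariant under the unit translation
`c ↦ c + m` (`thetaIdeal_heckeCoord_add_intCast`) and `c ↦ 1 - c` preserves Lebesgue measure on the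
unit cube (Neukirch VII (5.8): `f_{F⁻¹}` versus `f_F`, where `F⁻¹` is again a fundamental domain).
[folklore] -/
theorem heckeFi_neg_one (I : FractionalIdeal (𝓞 K)⁰ K) (t : ℝ) : heckeFi K I (-1) t = heckeFi K I 1 t := by
  unfold heckeFi
  set F : (Fin (rank K) → ℝ) → ℝ := fun c ↦ thetaIdeal K I (heckeCoord K c t) with hF
  have h1 : ∀ c : Fin (rank K) → ℝ, thetaIdeal K I (heckeCoord K ((-1 : ℝ) • c) t) =
      F ((1 : Fin (rank K) → ℝ) - c) := by
    intro c
    rw [hF]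
    simp only
    rw [← thetaIdeal_heckeCoord_add_intCast I ((1 : Fin (rank K) → ℝ) - c) (fun _ ↦ (-1 : ℤ)) t]
    congr 2
    funext i
    simp only [Pi.smul_apply, smul_eq_mul, neg_mul, one_mul, Pi.add_apply, Pi.sub_apply,
      Pi.one_apply, Int.cast_neg, Int.cast_one]
    ring
  have h2 : ∀ c : Fin (rank K) → ℝ, thetaIdeal K I (heckeCoord K ((1 : ℝ) • c) t) = F c := by
    intro c; rw [one_smul]
  simp_rw [h1, h2]
  have hmem : ∀ c : Fin (rank K) → ℝ, c ∈ Icc (0 : Fin (rank K) → ℝ) 1 ↔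
      (1 : Fin (rank K) → ℝ) - c ∈ Icc (0 : Fin (rank K) → ℝ) 1 := by
    intro c
    simp only [mem_Icc, Pi.le_def, Pi.one_apply, Pi.zero_apply, sub_nonneg,
      sub_le_self_iff]
    exact ⟨fun h ↦ ⟨h.2, h.1⟩, fun h ↦ ⟨h.2, h.1⟩⟩
  have hind : ∀ c, (Icc (0 : Fin (rank K) → ℝ) 1).indicator (fun c ↦ F (1 - c)) c =
      (Icc (0 : Fin (rank K) → ℝ) 1).indicator F (1 - c) := by
    intro c
    by_cases hc : c ∈ Icc (0 : Fin (rank K) → ℝ) 1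
    · rw [indicator_of_mem hc, indicator_of_mem ((hmem c).mp hc)]
    · rw [indicator_of_notMem hc, indicator_of_notMem (fun h ↦ hc ((hmem c).mpr h))]
  calc ∫ c in Icc 0 1, F (1 - c)
      = ∫ c, (Icc (0 : Fin (rank K) → ℝ) 1).indicator (fun c ↦ F (1 - c)) c :=
        (integral_indicator measurableSet_Icc).symm
    _ = ∫ c, (Icc (0 : Fin (rank K) → ℝ) 1).indicator F (1 - c) := by simp_rw [hind]
    _ = ∫ c, (Icc (0 : Fin (rank K) → ℝ) 1).indicator F c :=
        integral_sub_left_eq_self _ volume 1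
    _ = ∫ c in Icc 0 1, F c := integral_indicator measurableSet_Icc

/-! ## The norm of the dual ideal and the symmetry of Hecke's FE-pair -/

/-- `𝔑((𝔞𝔡)⁻¹) = (𝔑(𝔞) |d_K|)⁻¹` (`(𝔞𝔡)⁻¹ = 𝔡⁻¹ 𝔞⁻¹`, Mathlib `FractionalIdeal.dual_eq_mul_inv`,
`coeIdeal_differentIdeal`, and `𝔑(𝔡) = |d_K|`, Mathlib `NumberField.absNorm_differentIdeal`;
Neukirch III (2.9)). [folklore] -/
theorem absNorm_dual (I : FractionalIdeal (𝓞 K)⁰ K) :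
    FractionalIdeal.absNorm (FractionalIdeal.dual ℤ ℚ I) =
      (FractionalIdeal.absNorm I)⁻¹ * ((discr K).natAbs : ℚ)⁻¹ := by
  rw [FractionalIdeal.dual_eq_mul_inv ℤ ℚ I, map_mul, map_inv₀]
  have h1 : FractionalIdeal.dual ℤ ℚ (1 : FractionalIdeal (𝓞 K)⁰ K) =
      ((differentIdeal ℤ (𝓞 K) : Ideal (𝓞 K)) : FractionalIdeal (𝓞 K)⁰ K)⁻¹ := by
    rw [coeIdeal_differentIdeal ℤ ℚ K, inv_inv]
  rw [h1, map_inv₀, FractionalIdeal.coeIdeal_absNorm, _root_.NumberField.absNorm_differentIdeal K (𝓞 K),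
    mul_comm]

/-- Two weak FE-pairs with the same data `(f, g, k, ε, f₀, g₀)` are equal (the remaining fields are
propositions). [folklore] -/
theorem weakFEPair_eq {E : Type*} [NormedAddCommGroup E] [NormedSpace ℂ E] {P Q : WeakFEPair E}
    (hf : P.f = Q.f) (hg : P.g = Q.g) (hk : P.k = Q.k) (hε : P.ε = Q.ε) (hf₀ : P.f₀ = Q.f₀)
    (hg₀ : P.g₀ = Q.g₀) : P = Q := by
  obtain ⟨f, g, k, ε, f₀, g₀, _, _, _, _, _, _, _⟩ := P
  obtain ⟨f', g', k', ε', f₀', g₀', _, _, _, _, _, _, _⟩ := Q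
  simp only at hf hg hk hε hf₀ hg₀
  subst hf hg hk hε hf₀ hg₀
  rfl

/-- `√|d_K| ≠ 0`. [folklore] -/
theorem sqrt_abs_discr_ne_zero : Real.sqrt |(discr K : ℝ)| ≠ 0 :=
  Real.sqrt_ne_zero'.mpr (abs_pos.mpr (Int.cast_ne_zero.mpr (discr_ne_zero K)))

/-- **Symmetry of Hecke's FE-pair**: swapping `f` and `g` in the weak FE-pair of `𝔞` gives the weak
FE-pair of the dual ideal `𝔞' = (𝔞𝔡)⁻¹`: `f_{𝔞',-1} = f_{𝔞',1}` (`heckeFi_neg_one`), `𝔞'' = 𝔞`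
(Mathlib `FractionalIdeal.dual_dual`) and `ε_𝔞⁻¹ = 𝔑(𝔞)√|d_K| = (𝔑(𝔞')√|d_K|)⁻¹ = ε_{𝔞'}`
(`absNorm_dual`) (Neukirch VII (5.8)–(5.9): `g_F(𝔞, ·) = f_{F⁻¹}((𝔞𝔡)⁻¹, ·)`). [folklore] -/
theorem heckePair_symm (hinv : thetaIdeal_inv K) (I : FractionalIdeal (𝓞 K)⁰ K) (hI : I ≠ 0) :
    (heckePair K hinv I hI).symm =
      heckePair K hinv (FractionalIdeal.dual ℤ ℚ I) (FractionalIdeal.dual_ne_zero ℤ ℚ hI) := by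
  refine weakFEPair_eq ?_ ?_ rfl ?_ rfl rfl
  · funext t
    show ((heckeFi K (FractionalIdeal.dual ℤ ℚ I) (-1) t : ℝ) : ℂ) =
      ((heckeFi K (FractionalIdeal.dual ℤ ℚ I) 1 t : ℝ) : ℂ)
    rw [heckeFi_neg_one]
  · funext t
    show ((heckeFi K I 1 t : ℝ) : ℂ) =
      ((heckeFi K (FractionalIdeal.dual ℤ ℚ (FractionalIdeal.dual ℤ ℚ I)) (-1) t : ℝ) : ℂ)
    rw [FractionalIdeal.dual_dual, heckeFi_neg_one]
  · show (((((FractionalIdeal.absNorm I : ℝ) * Real.sqrt |(discr K : ℝ)|)⁻¹ : ℝ) : ℂ))⁻¹ =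
      (((((FractionalIdeal.absNorm (FractionalIdeal.dual ℤ ℚ I) : ℝ) * Real.sqrt |(discr K : ℝ)|)⁻¹ :
        ℝ) : ℂ))
    rw [← Complex.ofReal_inv, inv_inv, absNorm_dual]
    congr 1
    have hd : Real.sqrt |(discr K : ℝ)| ≠ 0 := sqrt_abs_discr_ne_zero
    have hN : (FractionalIdeal.absNorm I : ℝ) ≠ 0 := by
      exact_mod_cast FractionalIdeal.absNorm_eq_zero_iff.not.mpr hI
    have hdd : ((discr K).natAbs : ℝ) = Real.sqrt |(discr K : ℝ)| ^ 2 := by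
      rw [Real.sq_sqrt (abs_nonneg _), Nat.cast_natAbs, Int.cast_abs]
    push_cast
    rw [hdd]
    field_simp

end Literature.NumberTheory.LFunctions.NumberField

namespace Literature.NumberTheory.LFunctions.NumberField

variable {K : Type*} [Field K] [NumberField K]

/-! ## Scaling: `Λ_{x𝔞}(z) = |N(x)|^{-2z} Λ_𝔞(z)` -/

section Scaling

open NumberField.mixedEmbedding NumberField.mixedEmbedding.fundamentalCone

/-- `heckePair` does not depend on the proof of `𝔞 ≠ 0`, nor on the syntactic form of `𝔞`. [folklore] -/
theorem heckePair_congr (hinv : thetaIdeal_inv K) {I J : FractionalIdeal (𝓞 K)⁰ K} (h : I = J)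
    (hI : I ≠ 0) (hJ : J ≠ 0) : heckePair K hinv I hI = heckePair K hinv J hJ := by
  subst h; rfl

/-- Membership in `x𝔞`: `b ∈ x𝔞 ↔ x⁻¹ b ∈ 𝔞` (`x ≠ 0`). [folklore] -/
theorem mem_spanSingleton_mul_iff {x : K} (hx : x ≠ 0) (I : FractionalIdeal (𝓞 K)⁰ K) (b : K) :
    b ∈ FractionalIdeal.spanSingleton (𝓞 K)⁰ x * I ↔ x⁻¹ * b ∈ I := by
  rw [FractionalIdeal.mem_singleton_mul]
  constructor
  · rintro ⟨b', hb', rfl⟩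
    rwa [inv_mul_cancel_left₀ hx]
  · intro h
    exact ⟨x⁻¹ * b, h, by rw [mul_inv_cancel_left₀ hx]⟩

/-- `x⁻¹ (x 𝔞) = 𝔞`. [folklore] -/
theorem spanSingleton_inv_mul_spanSingleton_mul {x : K} (hx : x ≠ 0) (I : FractionalIdeal (𝓞 K)⁰ K) :
    FractionalIdeal.spanSingleton (𝓞 K)⁰ x⁻¹ * (FractionalIdeal.spanSingleton (𝓞 K)⁰ x * I) = I := by
  rw [← mul_assoc, FractionalIdeal.spanSingleton_mul_spanSingleton, inv_mul_cancel₀ hx,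
    FractionalIdeal.spanSingleton_one, one_mul]

/-- **The cone points of `𝔞` and of `x𝔞` correspond**, for `x ∈ K^×`, by a bijection multiplying
`|N_{K/ℚ}|` by `|N_{K/ℚ}(x)|`: `a ↦` the cone representative `ε_{m(xa)} xa` of `xa` (both sides are
systems of representatives of the nonzero elements modulo units, counted with the torsion, and
`a ↦ xa` is a unit-equivariant bijection `𝔞 ∖ 0 → x𝔞 ∖ 0`; units have norm `±1`, Mathlib
`NumberField.Units.norm`). This is why the partial zeta function of Neukirch VII (5.3) depends only
on the ideal class. [folklore] -/
theorem exists_coneEquiv_spanSingleton_mul {x : K} (hx : x ≠ 0) (I : FractionalIdeal (𝓞 K)⁰ K) :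
    ∃ e : conePoints K I ≃ conePoints K (FractionalIdeal.spanSingleton (𝓞 K)⁰ x * I),
      ∀ a, |(Algebra.norm ℚ ((e a : conePoints K _) : K) : ℚ)| =
        |(Algebra.norm ℚ x : ℚ)| * |(Algebra.norm ℚ (a : K) : ℚ)| := by
  classical
  -- the cone representative `ρ(a) = ε_{m(a)} a` of `a ≠ 0` (and `ρ(0) = 0`)
  let ρ : K → K := fun a ↦ if h : a = 0 then 0 else (fundUnit K (coneExponent a h) : K) * a
  have hρ_mem : ∀ {a : K}, a ≠ 0 → mixedEmbedding K (ρ a) ∈ fundamentalCone K := fun {a} ha ↦ by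
    simp only [ρ, dif_neg ha]; exact coneExponent_spec a ha
  have hρ_eq : ∀ {a : K} (ha : a ≠ 0) {m : Fin (rank K) → ℤ},
      mixedEmbedding K ((fundUnit K m : K) * a) ∈ fundamentalCone K → ρ a = (fundUnit K m : K) * a :=
    fun {a} ha {m} hm ↦ by simp only [ρ, dif_neg ha]; rw [coneExponent_eq ha hm]
  have hρ_cone : ∀ {J : FractionalIdeal (𝓞 K)⁰ K} {a : K}, a ∈ conePoints K J → ρ a = a :=
    fun {J} {a} ha ↦ by
    have h1 : (fundUnit K 0 : K) * a = a := by rw [fundUnit_zero, Units.val_one, map_one, one_mul]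
    have hm : mixedEmbedding K ((fundUnit K 0 : K) * a) ∈ fundamentalCone K := by rw [h1]; exact ha.2
    rw [hρ_eq (ne_zero_of_mem_conePoints ha) hm, h1]
  have hρ_unit : ∀ (m : Fin (rank K) → ℤ) {a : K}, a ≠ 0 → ρ ((fundUnit K m : K) * a) = ρ a :=
    fun m {a} ha ↦ by
    have hma : (fundUnit K m : K) * a ≠ 0 := mul_ne_zero (coe_ne_zero _) ha
    have h1 : ρ a = (fundUnit K (coneExponent a ha) : K) * a := by simp only [ρ, dif_neg ha]
    have hmem : mixedEmbedding K ((fundUnit K (coneExponent a ha - m) : K) * ((fundUnit K m : K) * a)) ∈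
        fundamentalCone K := by
      rw [← mul_assoc, ← coe_mul, ← fundUnit_add, sub_add_cancel, ← h1]
      exact hρ_mem ha
    rw [hρ_eq hma hmem, ← mul_assoc, ← coe_mul, ← fundUnit_add, sub_add_cancel, h1]
  have hρ_norm : ∀ a : K, |(Algebra.norm ℚ (ρ a) : ℚ)| = |(Algebra.norm ℚ a : ℚ)| := fun a ↦ by
    by_cases ha : a = 0
    · subst ha
      simp only [ρ, dif_pos]
    · simp only [ρ, dif_neg ha]
      rw [map_mul, abs_mul, NumberField.Units.norm, one_mul]
  -- `ρ(ya) ∈ y𝔟` for `a ∈ 𝔟`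
  have hρ_mul_mem : ∀ {y : K} (hy : y ≠ 0) {J : FractionalIdeal (𝓞 K)⁰ K} {a : K}, a ∈ J →
      ρ (y * a) ∈ FractionalIdeal.spanSingleton (𝓞 K)⁰ y * J := fun {y} hy {J} {a} ha ↦ by
    by_cases hya : y * a = 0
    · simp only [ρ, dif_pos hya]; exact FractionalIdeal.zero_mem _
    · simp only [ρ, dif_neg hya]
      refine unit_mul_mem _ ((mem_spanSingleton_mul_iff hy J _).mpr ?_)
      rwa [inv_mul_cancel_left₀ hy]
  -- `ρ(y⁻¹ ρ(y a)) = a` for a cone point `a`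
  have hρ_inv : ∀ {y : K} (hy : y ≠ 0) {J : FractionalIdeal (𝓞 K)⁰ K} {a : K}, a ∈ conePoints K J →
      ρ (y⁻¹ * ρ (y * a)) = a := fun {y} hy {J} {a} ha ↦ by
    have ha0 := ne_zero_of_mem_conePoints ha
    have hya : y * a ≠ 0 := mul_ne_zero hy ha0
    have : y⁻¹ * ρ (y * a) = (fundUnit K (coneExponent (y * a) hya) : K) * a := by
      simp only [ρ, dif_neg hya]; field_simp
    rw [this, hρ_unit _ ha0, hρ_cone ha]
  refine ⟨{ toFun := fun a ↦ ⟨ρ (x * a), hρ_mul_mem hx a.2.1,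
              hρ_mem (mul_ne_zero hx (ne_zero_of_mem_conePoints a.2))⟩
            invFun := fun b ↦ ⟨ρ (x⁻¹ * b), by
              have h := hρ_mul_mem (inv_ne_zero hx) b.2.1
              rwa [spanSingleton_inv_mul_spanSingleton_mul hx I] at h,
              hρ_mem (mul_ne_zero (inv_ne_zero hx) (ne_zero_of_mem_conePoints b.2))⟩
            left_inv := fun a ↦ Subtype.ext (hρ_inv hx a.2)
            right_inv := fun b ↦ Subtype.ext (by
              have h := hρ_inv (inv_ne_zero hx) b.2
              rwa [inv_inv] at h) }, fun a ↦ ?_⟩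
  show |(Algebra.norm ℚ (ρ (x * (a : K))) : ℚ)| = _
  rw [hρ_norm, map_mul, abs_mul]

/-- **Scaling of the unfolded Mellin transform**: for `x ∈ K^×` and real `σ > 0`,
`∫ t^{σ-1}(f_{x𝔞}(t) - 1) dt = |N(x)|^{-2σ} ∫ t^{σ-1}(f_𝔞(t) - 1) dt` (`ℝ≥0∞`-valued): both sides are
sums over cone points (`lintegral_Ioi_rpow_mul_heckeFi_sub_one`) of `C · ∏_w(…) · |N(a)|^{-2σ}`
(`prod_gammaFactor_eq_mul_norm_rpow`), matched by the cone correspondence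
`exists_coneEquiv_spanSingleton_mul`, which
multiplies norms by `|N(x)|` (Neukirch VII (5.3)–(5.5)). [folklore] -/
theorem lintegral_heckeFi_spanSingleton_mul {x : K} (hx : x ≠ 0) (I : FractionalIdeal (𝓞 K)⁰ K)
    {σ : ℝ} (hσ : 0 < σ) :
    ∫⁻ t in Ioi 0, ENNReal.ofReal (t ^ (σ - 1)) *
        ENNReal.ofReal (heckeFi K (FractionalIdeal.spanSingleton (𝓞 K)⁰ x * I) 1 t - 1) =
      ENNReal.ofReal ((|(Algebra.norm ℚ x : ℚ)| : ℝ) ^ (-2 * σ)) *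
        ∫⁻ t in Ioi 0, ENNReal.ofReal (t ^ (σ - 1)) * ENNReal.ofReal (heckeFi K I 1 t - 1) := by
  obtain ⟨e, he⟩ := exists_coneEquiv_spanSingleton_mul hx I
  rw [lintegral_Ioi_rpow_mul_heckeFi_sub_one _ hσ, lintegral_Ioi_rpow_mul_heckeFi_sub_one _ hσ,
    ← e.tsum_eq, ← ENNReal.tsum_mul_left]
  refine tsum_congr fun a ↦ ?_
  rw [prod_gammaFactor_eq_mul_norm_rpow _ (ne_zero_of_mem_conePoints (e a).2) σ,
    prod_gammaFactor_eq_mul_norm_rpow _ (ne_zero_of_mem_conePoints a.2) σ]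
  have hn := congr_arg (Rat.cast : ℚ → ℝ) (he a)
  push_cast at hn
  rw [hn, Real.mul_rpow (by positivity) (by positivity), ← ENNReal.ofReal_mul (by positivity)]
  congr 1
  ring

/-- **Scaling of `Λ` at real points**: `Λ_{x𝔞}(σ) = |N(x)|^{-2σ} Λ_𝔞(σ)` for `σ > 1/2`. [folklore] -/
theorem heckePair_Λ_spanSingleton_mul_ofReal (hinv : thetaIdeal_inv K) {x : K} (hx : x ≠ 0)
    (I : FractionalIdeal (𝓞 K)⁰ K) (hI : I ≠ 0)
    (hxI : FractionalIdeal.spanSingleton (𝓞 K)⁰ x * I ≠ 0) {σ : ℝ} (hσ : 1 / 2 < σ) :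
    (heckePair K hinv (FractionalIdeal.spanSingleton (𝓞 K)⁰ x * I) hxI).Λ σ =
      ((|(Algebra.norm ℚ x : ℚ)| : ℝ) : ℂ) ^ (-(2 * (σ : ℂ))) * (heckePair K hinv I hI).Λ σ := by
  obtain ⟨-, hΛ⟩ := heckePair_Λ_ofReal hinv I hI hσ
  obtain ⟨-, hΛ'⟩ := heckePair_Λ_ofReal hinv _ hxI hσ
  rw [hΛ', hΛ, lintegral_heckeFi_spanSingleton_mul hx I (by linarith), ENNReal.toReal_mul,
    ENNReal.toReal_ofReal (Real.rpow_nonneg (by positivity) _), Complex.ofReal_mul,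
    Complex.ofReal_cpow (by positivity)]
  push_cast
  ring_nf

/-- **Scaling of `Λ`**: for `x ∈ K^×` and a nonzero fractional ideal `𝔞`,
`Λ_{x𝔞}(z) = |N_{K/ℚ}(x)|^{-2z} Λ_𝔞(z)` for all `z ∉ {0, 1/2}` (off the poles): at real `z > 1/2`
by `heckePair_Λ_spanSingleton_mul_ofReal`, in general by the identity theorem on the connected open
set `ℂ ∖ {0, 1/2}`, where both sides are holomorphic (Mathlib `WeakFEPair.differentiableAt_Λ`).
This is the independence of `𝔑(𝔞)^{2z} Λ_𝔞(z)` from the representative `𝔞` of its ideal class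
(Neukirch VII (5.9): `Z(𝔎, 2z)`). [cite: NeukirchANT1999, Ch. VII (5.9)] -/
theorem heckePair_Λ_spanSingleton_mul (hinv : thetaIdeal_inv K) {x : K} (hx : x ≠ 0)
    (I : FractionalIdeal (𝓞 K)⁰ K) (hI : I ≠ 0)
    (hxI : FractionalIdeal.spanSingleton (𝓞 K)⁰ x * I ≠ 0) {z : ℂ} (hz0 : z ≠ 0)
    (hz : z ≠ ((1 / 2 : ℝ) : ℂ)) :
    (heckePair K hinv (FractionalIdeal.spanSingleton (𝓞 K)⁰ x * I) hxI).Λ z =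
      ((|(Algebra.norm ℚ x : ℚ)| : ℝ) : ℂ) ^ (-(2 * z)) * (heckePair K hinv I hI).Λ z := by
  set P := heckePair K hinv I hI with hP
  set P' := heckePair K hinv (FractionalIdeal.spanSingleton (𝓞 K)⁰ x * I) hxI with hP'
  set c : ℂ := ((|(Algebra.norm ℚ x : ℚ)| : ℝ) : ℂ) with hc
  have hc0 : c ≠ 0 := by
    rw [hc]; exact_mod_cast (abs_pos.mpr ((Algebra.norm_ne_zero_iff).mpr hx)).ne'
  obtain ⟨G₁, hG₁⟩ : ∃ G₁ : ℂ → ℂ, G₁ = fun z ↦ P'.Λ z := ⟨_, rfl⟩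
  obtain ⟨G₂, hG₂⟩ : ∃ G₂ : ℂ → ℂ, G₂ = fun z ↦ c ^ (-(2 * z)) * P.Λ z := ⟨_, rfl⟩
  set V : Set ℂ := ({0, ((1 / 2 : ℝ) : ℂ)} : Set ℂ)ᶜ with hV
  have hmemV_iff : ∀ w : ℂ, w ∈ V ↔ w ≠ 0 ∧ w ≠ ((1 / 2 : ℝ) : ℂ) := fun w ↦ by
    rw [hV, mem_compl_iff, mem_insert_iff, mem_singleton_iff, not_or]
  have hzV : z ∈ V := (hmemV_iff z).mpr ⟨hz0, hz⟩
  suffices h : EqOn G₁ G₂ V by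
    have := h hzV
    rwa [hG₁, hG₂] at this
  have hVo : IsOpen V := (Set.toFinite _).isClosed.isOpen_compl
  have hVc : IsPreconnected V :=
    (Set.Countable.isPathConnected_compl_of_one_lt_rank (rank_real_complex ▸ Nat.one_lt_ofNat)
      (Set.toFinite _).countable).isConnected.isPreconnected
  have h1V : (1 : ℂ) ∈ V := by
    refine (hmemV_iff 1).mpr ⟨one_ne_zero, fun h ↦ ?_⟩
    have := congr_arg Complex.re h
    norm_num at this
  have hmemV : ∀ w ∈ V, w ≠ 0 ∧ w ≠ ((1 / 2 : ℝ) : ℂ) := fun w hw ↦ (hmemV_iff w).mp hw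
  -- analyticity
  have hΛa : ∀ (Q : WeakFEPair ℂ), Q.k = 1 / 2 → AnalyticOnNhd ℂ Q.Λ V := fun Q hQ ↦ by
    refine DifferentiableOn.analyticOnNhd (fun w hw ↦ ?_) hVo
    refine (Q.differentiableAt_Λ (Or.inl (hmemV w hw).1) (Or.inl ?_)).differentiableWithinAt
    rw [hQ]; exact (hmemV w hw).2
  have hG₁a : AnalyticOnNhd ℂ G₁ V := by rw [hG₁]; exact hΛa P' rfl
  have hG₂a : AnalyticOnNhd ℂ G₂ V := by
    rw [hG₂]
    have h2 : AnalyticOnNhd ℂ (fun z : ℂ ↦ c ^ (-(2 * z))) V :=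
      DifferentiableOn.analyticOnNhd (fun w _ ↦ (DifferentiableAt.const_cpow
        ((differentiableAt_id.const_mul _).neg) (Or.inl hc0)).differentiableWithinAt) hVo
    exact h2.mul (hΛa P rfl)
  -- equality at real points `σ > 1/2`
  have hreal : ∀ σ : ℝ, 1 / 2 < σ → G₁ σ = G₂ σ := fun σ hσ ↦ by
    rw [hG₁, hG₂]
    exact heckePair_Λ_spanSingleton_mul_ofReal hinv hx I hI hxI hσ
  -- `G₁ = G₂` frequently near `1`
  have hfreq : ∃ᶠ w in 𝓝[≠] (1 : ℂ), G₁ w = G₂ w := by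
    set u : ℕ → ℝ := fun n ↦ 1 + 1 / ((n : ℝ) + 1) with hu
    have hu1 : Tendsto u atTop (𝓝 1) := by
      have := tendsto_one_div_add_atTop_nhds_zero_nat.const_add (1 : ℝ)
      rwa [add_zero] at this
    have hu2 : Tendsto (fun n ↦ ((u n : ℝ) : ℂ)) atTop (𝓝 ((1 : ℝ) : ℂ)) :=
      (Complex.continuous_ofReal.tendsto _).comp hu1
    rw [Complex.ofReal_one] at hu2
    have ht : Tendsto (fun n ↦ ((u n : ℝ) : ℂ)) atTop (𝓝[≠] (1 : ℂ)) := by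
      refine tendsto_nhdsWithin_of_tendsto_nhds_of_eventually_within _ hu2
        (Eventually.of_forall fun n ↦ ?_)
      simp only [mem_compl_iff, mem_singleton_iff, Complex.ofReal_eq_one, hu]
      have : (0 : ℝ) < 1 / ((n : ℝ) + 1) := by positivity
      linarith
    refine ht.frequently (Eventually.frequently (Eventually.of_forall fun n ↦ ?_))
    have : (0 : ℝ) < 1 / ((n : ℝ) + 1) := by positivity
    exact hreal (u n) (by simp only [hu]; linarith)
  exact hG₁a.eqOn_of_preconnected_of_frequently_eq hG₂a hVc h1V hfreq

end Scaling

end Literature.NumberTheory.LFunctions.NumberField
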